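import Literature.AlgebraicGeometry.Resolution.EquivariantProjectiveEmbedding
import Literature.AlgebraicGeometry.Resolution.EquivariantStrongProjectiveResolution
import Literature.AlgebraicGeometry.Resolution.StableReducedSubschemeAction
import Literature.AlgebraicGeometry.Resolution.EmbeddedResolutionCentre
import Literature.AlgebraicGeometry.Resolution.ChowLemmaProofs
import HarnessLib

/-!
# Equivariant regular projective completion of a regular affine variety with a finite group action (char. 0)

Topic `Literature/AlgebraicGeometry/Resolution`. ONE THEOREM (no definition, no named fact); the
`attribute [local instance] MvPolynomial.gradedAlgebra` line is the tree's standard one (to speak about `Proj K[x₀, …, xₙ]`).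

**Statement** (`exists_equivariant_completion_resolution`). Let `K` be a field of characteristic zero, `U` an affine
integral `K`-scheme of finite type with regular local rings, and `ρ` an action of a finite group `G` on `U` over `K`.
Then there are an integral PROJECTIVE `K`-scheme `N` with a `G`-action `ρN` over `K`, a `G`-equivariant open immersion
`ι : U ↪ N` over `K`, and a resolution of singularities `r : Y → N` (proper, birational, `Y` regular) with `Y`
projective over `K`, `r` an ISOMORPHISM over the open `ι(U)`, and a `G`-action on `Y` over `K` making `r`
equivariant. In particular `U ↪ r⁻¹(ι U) ⊆ Y` is an equivariant open immersion into an integral regular projective `G`-scheme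
(`exists_equivariant_regular_projective_completion`, the consumer-facing corollary).

**Proof** (Kollár 2007, Thm. 3.36 (1)(2)(4) with §3.4.1 «any group action on `X` lifts to `X′`», through the
tree's PROVED embedded equivariant strong resolution, not the named fact `Kollar2007_resolutionLiftsAutomorphisms`):
* `f : U ↪ ℙⁿ_K`, an immersion equivariant for a linear action `ρP` of `G` on `ℙⁿ_K` over `K`
  (`exists_equivariant_immersion_proj`: `G`-stable generators of `Γ(U)`, Mumford AV §7);
* `Z := f(U)⁻` with its reduced structure = the scheme-theoretic image of `f` (`U` is reduced:
  `ker_eq_vanishingIdeal_of_isReduced`; integral by `ChowLemmaProof.isIntegral_image`), `G`-stable since `f(U)` is,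
  so `ρP` restricts to `Z` (`exists_action_restrict_vanishingIdeal_subscheme`, Görtz–Wedhorn 3.51–3.52) and the open
  immersion `j : U ↪ Z` (Mathlib `Scheme.Hom.toImage`) is equivariant (cancel the monomorphism `Z ↪ ℙⁿ_K`);
* `O := ℙⁿ_K ∖ ι_Z(Z ∖ j(U))` is open with `ι_Z⁻¹(O) = j(U)`, over which `Z ≅ U` is regular;
* `Kollar2007.exists_equivariant_isResolution_isProjectiveOver_isIso_proj` (`EquivariantStrongProjectiveResolution`)
  resolves `Z ⊂ ℙⁿ_K` by a projective `Y`, isomorphically over `ι_Z⁻¹(O)`, with a lifted action.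

Use (route `HodgeConjecture/Q8SymplecticPowers`, crux K1Q stmt-HodgeConjecture-24190, brick «B3»∕P-3′): this is the input
of `HodgeTheory.Q8Family.exists_genericModel(_of_surfaceLifting)` for the generic étale chart of the quaternionic quartic
family, now fact-free (`QuaternionicQuarticGenericModelHolds`). Route-agnostic; nothing here bears on HC.

## References

* [Kollar2007] J. Kollár, Lectures on Resolution of Singularities (2007), Thm. 3.36 (1)(2)(4) (p. 132), §3.4.1 (p. 121).
* [MumfordAV1970] D. Mumford, Abelian Varieties (1970), §7 (proof of the Theorem, p. 66).
* [GortzWedhorn2020] U. Görtz, T. Wedhorn, Algebraic Geometry I, 2nd ed. (2020), Props. 3.51–3.52, §(12.15).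
* [Hironaka1964] H. Hironaka, Ann. of Math. 79 (1964), Main Theorem I.
-/

noncomputable section

universe u

open CategoryTheory AlgebraicGeometry MvPolynomial TopologicalSpace

attribute [local instance] MvPolynomial.gradedAlgebra

namespace Literature.AlgebraicGeometry.Resolution

open Literature.AlgebraicGeometry.Motives Literature.AlgebraicGeometry.RelativeSpec Scheme.IdealSheafData

/-- **Equivariant regular projective completion with an equivariant resolution that is an isomorphism over the
chart.** Let `K` be a field of characteristic zero, `U` an affine integral `K`-scheme of finite type all of whose
local rings are regular, and `ρ` an action of a finite group `G` on `U` over `K`. Then there are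
* an integral PROJECTIVE `K`-scheme `N` with an action `ρN` of `G` over `K` and a `G`-equivariant open immersion
  `ι : U ↪ N` over `K` (the reduced closure of `U` in `ℙⁿ_K` under an equivariant immersion with linear action,
  `exists_equivariant_immersion_proj`, `exists_action_restrict_vanishingIdeal_subscheme`), and
* a resolution of singularities `r : Y → N` (`IsResolution`: proper, birational, `Y` regular) with `Y`
  projective over `K`, which is an ISOMORPHISM over (the open with underlying set) `ι(U)`, and an action `ρY` of `G` on `Y` over `K` for which
  `r` is equivariant (Kollár 2007 Thm. 3.36 (1)(2)(4) / §3.4.1 for ONE resolution, in the tree's proved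
  embedded form `Kollar2007.exists_equivariant_isResolution_isProjectiveOver_isIso_proj`, applied over the open
  `ℙⁿ_K ∖ (N ∖ ι(U))`).
This is exactly the input of the «generic smooth projective model» construction of
`HodgeTheory/QuaternionicQuarticGenericModel(OfLifting)`, now WITHOUT the named fact
`Kollar2007_resolutionLiftsAutomorphisms`. [cite: Kollar2007, Thm. 3.36 (1)(2)(4) and §3.4.1 (p. 121)]
[cite: MumfordAV1970, §7 (proof of the Theorem, p. 66)] -/
theorem exists_equivariant_completion_resolution {K : Type u} [Field K] [CharZero K] (U : SchemeOver K)
    [IsAffine U.left] [IsIntegral U.left] [LocallyOfFiniteType U.hom]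
    (hU : ∀ x : U.left, IsRegularLocalRing (U.left.presheaf.stalk x))
    {G : Type*} [Group G] [Finite G] (ρ : ActionOver U.hom G) :
    ∃ (N : SchemeOver K) (_ : IsIntegral N.left) (ρN : ActionOver N.hom G) (ι : U ⟶ N)
      (Y : Scheme.{u}) (r : Y ⟶ N.left) (ρY : ActionOver (r ≫ N.hom) G),
      IsProjectiveOver N ∧ IsOpenImmersion ι.left ∧ (∀ g, (ρ.aut g).hom ≫ ι.left = ι.left ≫ (ρN.aut g).hom) ∧
      IsResolution r ∧ IsProjectiveOver (Over.mk (r ≫ N.hom)) ∧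
      (∃ V : N.left.Opens, (V : Set N.left) = Set.range ι.left ∧ IsIso (r ∣_ V)) ∧
      ∀ g, (ρY.aut g).hom ≫ r = r ≫ (ρN.aut g).hom := by
  classical
  -- ### (1) the equivariant immersion `f : U ↪ ℙⁿ_K`
  obtain ⟨n, f, ρP, hf, hfK, hρPK, hfeq⟩ := exists_equivariant_immersion_proj U.hom ρ
  haveI := hf
  haveI : IsAffineHom U.hom := inferInstance
  haveI : IsProper (ProjBaseChange.projToSpec (Fin (n + 1)) K) := Kollar2007.isProper_projToSpec (K := K) (n := n)
  haveI : QuasiCompact (f ≫ ProjBaseChange.projToSpec (Fin (n + 1)) K) := by rw [hfK]; infer_instance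
  haveI : QuasiCompact f := QuasiCompact.of_comp f (ProjBaseChange.projToSpec (Fin (n + 1)) K)
  -- ### (2) its scheme-theoretic image `Z` = the reduced closed subscheme on `closure f(U)`, `G`-stable
  let C : Closeds (Proj (homogeneousSubmodule (Fin (n + 1)) K)) := ⟨closure (Set.range f), isClosed_closure⟩
  have hI : f.ker = vanishingIdeal C := ker_eq_vanishingIdeal_of_isReduced f
  haveI : IsIntegral f.image := ChowLemmaProof.isIntegral_image f
  let j : U.left ⟶ f.image := f.toImage
  have hj : j ≫ f.imageι = f := f.toImage_imageι
  -- `ρP g` preserves `f(U)` (equivariance), hence its closure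
  have hinv : ∀ (g : G) (x : Proj (homogeneousSubmodule (Fin (n + 1)) K)),
      (ρP g⁻¹).hom ((ρP g).hom x) = x := fun g x => by
    rw [← Scheme.Hom.comp_apply, ← Iso.trans_hom, ← Aut.Aut_mul_def, ← map_mul, inv_mul_cancel, map_one]
    rfl
  have hst : ∀ g : G, (ρP g).hom ⁻¹' Set.range f = Set.range f := by
    intro g
    ext x
    constructor
    · rintro ⟨u, hu⟩
      refine ⟨(ρ.aut g⁻¹).hom u, ?_⟩
      rw [← Scheme.Hom.comp_apply, hfeq, Scheme.Hom.comp_apply, hu, hinv]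
    · rintro ⟨u, rfl⟩
      refine ⟨(ρ.aut g).hom u, ?_⟩
      rw [← Scheme.Hom.comp_apply, hfeq, Scheme.Hom.comp_apply]
  have hCst : ∀ g : G, (ρP g).hom ⁻¹' (C : Set (Proj (homogeneousSubmodule (Fin (n + 1)) K))) = C := by
    intro g
    change (ρP g).hom.homeomorph ⁻¹' closure (Set.range f) = closure (Set.range f)
    rw [(ρP g).hom.homeomorph.preimage_closure]
    exact congrArg closure (hst g)
  obtain ⟨ρZ, hρZ⟩ : ∃ ρZ : G →* Aut f.image, ∀ g, (ρZ g).hom ≫ f.imageι = f.imageι ≫ (ρP g).hom := by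
    change ∃ ρZ : G →* Aut f.ker.subscheme, ∀ g, (ρZ g).hom ≫ f.ker.subschemeι = f.ker.subschemeι ≫ (ρP g).hom
    rw [hI]
    exact exists_action_restrict_vanishingIdeal_subscheme ρP C hCst
  -- ### (3) `N := Z` over `K`, the open immersion `ι := j`, equivariance
  let N : SchemeOver K := Over.mk (f.imageι ≫ ProjBaseChange.projToSpec (Fin (n + 1)) K)
  let ρN : ActionOver N.hom G :=
    ⟨ρZ, fun g => by
      change (ρZ g).hom ≫ f.imageι ≫ _ = f.imageι ≫ _
      rw [← Category.assoc, hρZ g, Category.assoc, hρPK g]⟩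
  have hjw : j ≫ N.hom = U.hom := by
    change j ≫ f.imageι ≫ _ = U.hom
    rw [← Category.assoc, hj, hfK]
  let ι : U ⟶ N := Over.homMk j hjw
  have hjeq : ∀ g, (ρ.aut g).hom ≫ j = j ≫ (ρZ g).hom := fun g => by
    rw [← cancel_mono f.imageι, Category.assoc, Category.assoc, hj, hρZ g, ← Category.assoc, hj, hfeq g]
  have hNproj : IsProjectiveOver N := ⟨n, Over.homMk f.imageι rfl, inferInstanceAs (IsClosedImmersion f.imageι)⟩
  -- ### (4) the open `O := ℙⁿ ∖ ι_Z(Z ∖ j(U))`, over which `Z` is `U`, hence regular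
  haveI : IsOpenImmersion j := inferInstance
  have hcl : IsClosed (f.imageι '' (Set.range j)ᶜ) :=
    f.imageι.isClosedEmbedding.isClosedMap _ (j.isOpenEmbedding.isOpen_range.isClosed_compl)
  let O : (Proj (homogeneousSubmodule (Fin (n + 1)) K)).Opens := ⟨(f.imageι '' (Set.range j)ᶜ)ᶜ, hcl.isOpen_compl⟩
  have hOj : ∀ z : f.image, f.imageι z ∈ O ↔ z ∈ Set.range j := by
    intro z
    change f.imageι z ∉ f.imageι '' (Set.range j)ᶜ ↔ _
    rw [f.imageι.isClosedEmbedding.injective.mem_set_image]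
    exact Set.notMem_compl_iff
  have hO : ∃ z : f.image, f.imageι z ∈ O := by
    obtain ⟨u⟩ := (inferInstance : Nonempty U.left)
    exact ⟨j u, (hOj _).mpr ⟨u, rfl⟩⟩
  have hreg : ∀ z : f.image, f.imageι z ∈ O → IsRegularLocalRing (f.image.presheaf.stalk z) := by
    intro z hz
    obtain ⟨u, rfl⟩ := (hOj z).mp hz
    haveI := hU u
    exact IsRegularLocalRing.of_ringEquiv (asIso (j.stalkMap u)).commRingCatIsoToRingEquiv.symm
  have hOeq : f.imageι ⁻¹ᵁ O = j.opensRange := by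
    ext z
    exact hOj z
  -- ### (5) Kollár's equivariant strong resolution of `Z ⊂ ℙⁿ_K` over `O`
  obtain ⟨Y, r, ρY', hr, hYproj, hiso, hYeq⟩ :=
    Kollar2007.exists_equivariant_isResolution_isProjectiveOver_isIso_proj f.imageι O hO hreg ρP hρPK ρZ hρZ
  rw [hOeq] at hiso
  let ρY : ActionOver (r ≫ N.hom) G :=
    ⟨ρY', fun g => by
      rw [← Category.assoc, hYeq g, Category.assoc]
      exact congrArg (r ≫ ·) (ρN.aut_comp g)⟩
  exact ⟨N, inferInstanceAs (IsIntegral f.image), ρN, ι, Y, r, ρY, hNproj, inferInstanceAs (IsOpenImmersion j),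
    hjeq, hr, hYproj, ⟨j.opensRange, Scheme.Hom.coe_opensRange j, hiso⟩, hYeq⟩

/-- Two morphisms into the source of `r` which agree after `r` and both land in an open `r⁻¹(V)` over which `r` is an
isomorphism coincide (the tree's `HodgeTheory.Q8Family.eq_of_comp_eq_of_range_subset`, restated here to keep the import
direction `Resolution → HodgeTheory`). [cite: Kollar2007, §3.4.1 (p. 121)] -/
private theorem eq_of_comp_eq_of_range_subset' {Z Y N : Scheme.{u}} (r : Y ⟶ N) (V : N.Opens) [IsIso (r ∣_ V)]
    {a b : Z ⟶ Y} (hab : a ≫ r = b ≫ r) (ha : ∀ z, r (a z) ∈ V) (hb : ∀ z, r (b z) ∈ V) : a = b := by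
  have hra : Set.range a ⊆ Set.range (r ⁻¹ᵁ V).ι := by
    rintro _ ⟨z, rfl⟩; rw [Scheme.Opens.range_ι]; exact ha z
  have hrb : Set.range b ⊆ Set.range (r ⁻¹ᵁ V).ι := by
    rintro _ ⟨z, rfl⟩; rw [Scheme.Opens.range_ι]; exact hb z
  have ha' : IsOpenImmersion.lift (r ⁻¹ᵁ V).ι a hra ≫ (r ⁻¹ᵁ V).ι = a := IsOpenImmersion.lift_fac _ _ _
  have hb' : IsOpenImmersion.lift (r ⁻¹ᵁ V).ι b hrb ≫ (r ⁻¹ᵁ V).ι = b := IsOpenImmersion.lift_fac _ _ _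
  have h1 : IsOpenImmersion.lift (r ⁻¹ᵁ V).ι a hra ≫ (r ∣_ V) = IsOpenImmersion.lift (r ⁻¹ᵁ V).ι b hrb ≫ (r ∣_ V) := by
    rw [← cancel_mono V.ι, Category.assoc, Category.assoc, morphismRestrict_ι, ← Category.assoc, ← Category.assoc,
      ha', hb', hab]
  rw [← ha', ← hb', (cancel_mono (r ∣_ V)).mp h1]

/-- **Equivariant regular projective completion of a regular affine `G`-variety** (`G` finite, characteristic `0`): an
integral REGULAR PROJECTIVE `K`-scheme `E` with an action of `G` over `K` and a `G`-equivariant open immersion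
`θ : U ↪ E` over `K` (`E` = the source of the resolution of `exists_equivariant_completion_resolution`,
`θ` = `U ≅ ι(U) ≅ r⁻¹(ι U) ⊆ E`; two lifts into `E` over the same map to `N` landing in `r⁻¹(ι U)` coincide).
Equivariant form of «Nagata + Hironaka» for affine varieties with a finite group action.
[cite: Kollar2007, Thm. 3.36 (1)(2)(4) and §3.4.1 (p. 121)] [cite: MumfordAV1970, §7 (proof of the Theorem, p. 66)] -/
theorem exists_equivariant_regular_projective_completion {K : Type u} [Field K] [CharZero K] (U : SchemeOver K)
    [IsAffine U.left] [IsIntegral U.left] [LocallyOfFiniteType U.hom]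
    (hU : ∀ x : U.left, IsRegularLocalRing (U.left.presheaf.stalk x))
    {G : Type*} [Group G] [Finite G] (ρ : ActionOver U.hom G) :
    ∃ (E : SchemeOver K) (ρE : ActionOver E.hom G) (θ : U ⟶ E),
      IsIntegral E.left ∧ Scheme.IsRegular E.left ∧ IsProjectiveOver E ∧ IsOpenImmersion θ.left ∧
      ∀ g, (ρ.aut g).hom ≫ θ.left = θ.left ≫ (ρE.aut g).hom := by
  obtain ⟨N, hNint, ρN, ι, Y, r, ρY, -, hιopen, hιeq, hr, hYproj, ⟨V, hV, hisoV⟩, hYeq⟩ :=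
    exists_equivariant_completion_resolution U hU ρ
  haveI := hNint
  haveI := hιopen
  haveI := hisoV
  have hVeq : V = ι.left.opensRange := Opens.ext (hV.trans (Scheme.Hom.coe_opensRange ι.left).symm)
  subst hVeq
  haveI : IrreducibleSpace Y := hr.isBirational.irreducibleSpace
  haveI : IsReduced Y := hr.isRegular.isReduced
  haveI : IsIntegral Y := isIntegral_of_irreducibleSpace_of_isReduced Y
  let E : SchemeOver K := Over.mk (r ≫ N.hom)
  -- the lift `θ : U ≅ ι(U) ≅ r⁻¹(ι U) ⊆ Y`
  let θl : U.left ⟶ Y := ι.left.isoOpensRange.hom ≫ inv (r ∣_ ι.left.opensRange) ≫ (r ⁻¹ᵁ ι.left.opensRange).ι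
  have hθr : θl ≫ r = ι.left := by
    change (ι.left.isoOpensRange.hom ≫ inv (r ∣_ ι.left.opensRange) ≫ (r ⁻¹ᵁ ι.left.opensRange).ι) ≫ r = ι.left
    rw [Category.assoc, Category.assoc, ← morphismRestrict_ι, IsIso.inv_hom_id_assoc, Scheme.Hom.isoOpensRange_hom_ι]
  have hθw : θl ≫ E.hom = U.hom := by
    change θl ≫ r ≫ N.hom = U.hom
    rw [← Category.assoc, hθr, Over.w ι]
  haveI : IsOpenImmersion θl := inferInstance
  refine ⟨E, ρY, Over.homMk θl hθw, inferInstanceAs (IsIntegral Y), hr.isRegular, hYproj,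
    inferInstanceAs (IsOpenImmersion θl), fun g => ?_⟩
  change (ρ.aut g).hom ≫ θl = θl ≫ (ρY.aut g).hom
  have hc : ((ρ.aut g).hom ≫ θl) ≫ r = ι.left ≫ (ρN.aut g).hom := by
    rw [Category.assoc, hθr]; exact hιeq g
  have hc' : (θl ≫ (ρY.aut g).hom) ≫ r = ι.left ≫ (ρN.aut g).hom := by
    rw [Category.assoc, hYeq g, ← Category.assoc, hθr]
  have hrange : ∀ u : U.left, (ι.left ≫ (ρN.aut g).hom) u ∈ ι.left.opensRange := fun u => by
    rw [← hιeq g, Scheme.Hom.comp_apply]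
    exact ⟨_, rfl⟩
  refine eq_of_comp_eq_of_range_subset' r ι.left.opensRange (hc.trans hc'.symm) (fun u => ?_) (fun u => ?_)
  · rw [← Scheme.Hom.comp_apply, hc]; exact hrange u
  · rw [← Scheme.Hom.comp_apply, hc']; exact hrange u

end Literature.AlgebraicGeometry.Resolution

end
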